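import Literature.MathematicalPhysics.QuantumLattice.CRPAScreeningMonotonicity
import Literature.MathematicalPhysics.QuantumLattice.WannierGaugeInteractionSums
import Summits.Ventures.CertifiedManyBodySolver.Downfold.EmeryBandLevelU
import Mathlib.Data.Complex.BigOperators
import HarnessLib

/-!
# The U leg of technique B is ONE-SIDED by a theorem: the one-band cRPA self-interaction of any orbital
# is at most its self-interaction with the three-band-screened kernel, and that composite expands in the
# three-band orbitals as the density–density `a²`-form whose `CuO₄` truncation is `bandLevelU`

Venture CertifiedManyBodySolver, cell `pub/hubbard-downfold` (stage S1 = ROUTER; INFLATION-RULES-3to1-B §B.4 /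
§B.14 / §B.24 / §B.28: the interaction leg of the three-band → one-band reduction), seat hubbard-downfold-mod-4
(technique B); namespace `Summit.Ventures.CertifiedManyBodySolver.Downfold.Emery`. Everything here is PROVED
(finite-basis linear algebra); no number about any material lives here.

The situation. The router's rule R-B17 (iii) pads the one-band `U/t` of a cuprate box ONE-SIDEDLY by the
technique-B annex `U_B = w²U_dd + (1 − w)²U_pp/4 + 2w(1 − w)U_pd` (`Downfold/EmeryBandLevelU.lean`, `w` = Cu-d
weight of the antibonding Wannier orbital), located on the same-construction (K) pairs (Vučičević et al. 2026)
as `U_1b ≤ U_B|full` on every parent. This file supplies the KERNEL of that sign. Setting (all finite): a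
common product / real-space grid `X` for both targets, an interaction kernel `W : Matrix X X ℂ`, an orbital
`w : X → ℂ`; its density `orbDensity w r = |w r|²` and its static SELF-INTERACTION
`selfU W w = re ⟨ρ_w, W ρ_w⟩ = re Σ_{r r'} |w r|² W r r' |w r'|²` (the diagonal two-body integral
`⟨ww|W|ww⟩`, `selfU_eq_twoBody`).

* §1 `selfU_mono` — `W₁ ≤ W₂` (Löwner) ⇒ `selfU W₁ w ≤ selfU W₂ w` for EVERY orbital (lit-1's
  `CRPAScreening.quadForm_mono` read on the density vector); hence, with lit-1's TARGET-SPACE MONOTONICITY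
  `CRPAScreening.targetSpace_monotone` (the three-band target removes more transition pieces from the screening
  than the one-band target, `P₃ ≤ P₁`, rest `P − P₃ ≤ 0`, bare `v > 0`):
  **`selfU_oneBand_le_threeBand`** — `selfU ((v⁻¹ − (P − P₁))⁻¹) w ≤ selfU ((v⁻¹ − (P − P₃))⁻¹) w`: the one-band
  cRPA `U` of the one-band Wannier orbital is at most the SAME orbital's self-interaction with the three-band
  cRPA kernel; also `selfU_screened_le_bare` (`≤` the bare self-interaction) and
  `selfU_fullyScreened_le_screened`.
* §2 the COMPOSITE EXPANSION: the one-band orbital as a combination `w = A *ᵥ c` of three-band orbitals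
  (columns of `A : Matrix X I ℂ`, any finite label set `I` = orbital × cell). Under ZERO DIFFERENTIAL OVERLAP
  (hypothesis `∀ r i j, i ≠ j → conj A r i · A r j = 0`: distinct columns have pointwise-disjoint supports — the
  density–density reading every cRPA table prints) the density is the weight combination `ρ_w = Σᵢ |cᵢ|² ρᵢ` (`orbDensity_mulVec_of_zdo`) and
  **`selfU_mulVec_of_zdo`**: `selfU W (A *ᵥ c) = Σᵢ Σⱼ |cᵢ|²|cⱼ|² · re D_{ij}[W]` with
  `D_{ij}[W] = ⟨ρᵢ, W ρⱼ⟩ = twoBody A W i j i j` (`densityDensity_eq_twoBody`, lit-1's `WannierGauge.twoBody`) —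
  the `a²`-FORM of INFLATION-RULES-3to1-B §B.4 with ALL pair terms. With the SAME kernel on both sides (the bare
  `v`) the expansion is an identity, which is the calibration test of the truncation (router §B.28: the (K) bare
  one-band `V` is reproduced to `[−1.2 %, +1.4 %]` by the `CuO₄` truncation on 26/26 compounds).
* §3 `weightedComposite a D = Σᵢⱼ aᵢaⱼD_{ij}` (real weights / real pair table): dropping non-negative
  off-diagonal pair terms LOWERS it (`diagComposite_le_weightedComposite`), and the `CuO₄` instance
  (`cuO4Weight`: `w` on Cu, `(1 − w)/4` on each of the four oxygens; `cuO4Kernel`: `U_dd`, `U_pp`, `U_pd` and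
  an inter-oxygen table `V`) evaluates to **`bandLevelU w U_dd U_pp U_pd + ((1 − w)/4)²·Σ_{k ≠ l} V k l`**
  (`weightedComposite_cuO4`), so `bandLevelU ≤` the `CuO₄` composite whenever the inter-oxygen terms are
  non-negative (`bandLevelU_le_weightedComposite_cuO4`).
* §4 the chain in one statement, `selfU_oneBand_le_weightedComposite_of_zdo`: under ZDO and the cRPA
  hypotheses, `U_1b(A *ᵥ c) ≤ Σᵢⱼ |cᵢ|²|cⱼ|² re D_{ij}[U^{3b}]`.

HONEST SCOPE. Hypotheses, not derivations: the sign of the polarization pieces and the nesting `P₃ ≤ P₁`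
(RPA, static limit), a COMMON basis for both targets (the printed one- and three-band Wannier constructions are
separate MLWF runs; the one-band orbital lies in the three-band subspace only up to disentanglement), ZDO (the
non-ZDO remainder = exchange / overlap-density integrals, not expanded here), and the truncation of the pair
table to the `CuO₄` unit (omitted: Cu–Cu′ and farther pair terms, orbital tails). The located sizes of these
remainders are router text (§B.24/§B.28), not theorems. WHAT THIS IS NOT: a cRPA calculation, a box, a hull
endpoint or a word; nothing here bears on order, pairing or `T_c`.

References: F. Aryasetiawan et al., Phys. Rev. B 70 (2004) 195104, §II · L. Vaugier, H. Jiang, S. Biermann,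
Phys. Rev. B 86 (2012) 165105, §IV.A · P. Werner, R. Sakuma, F. Nilsson, F. Aryasetiawan, Phys. Rev. B 91 (2015)
125142, §III.A (one-band `U_dd` 3.65 eV vs three-band 7.00 eV in La₂CuO₄) · T. Miyake, F. Aryasetiawan, Phys.
Rev. B 77 (2008) 085122, §IV · A. Szabo, N. S. Ostlund, *Modern Quantum Chemistry* (1996) §3.2.3.
-/

noncomputable section

open scoped ComplexOrder MatrixOrder BigOperators ComplexConjugate

namespace Summit.Ventures.CertifiedManyBodySolver.Downfold.Emery

open Matrix Complex Literature.MathematicalPhysics.QuantumLattice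

variable {X I : Type*} [Fintype X] [Fintype I]

/-! ## §1 The self-interaction of an orbital and its Löwner monotonicity -/

/-- **Orbital density** `ρ_w(r) = |w(r)|²` of an orbital on the finite grid `X`, as a complex vector (real,
non-negative entries). [cite: MiyakeAryasetiawan2008, §IV] -/
def orbDensity (w : X → ℂ) : X → ℂ := fun r => ((Complex.normSq (w r) : ℝ) : ℂ)

omit [Fintype X] in
/-- `ρ_w(r) = conj w(r) · w(r)`. [folklore] -/
theorem orbDensity_apply (w : X → ℂ) (r : X) : orbDensity w r = star (w r) * w r := by
  simp [orbDensity, Complex.normSq_eq_conj_mul_self]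

omit [Fintype X] in
/-- The density vector is real: `star ρ_w = ρ_w`. [folklore] -/
theorem star_orbDensity (w : X → ℂ) : star (orbDensity w) = orbDensity w := by
  funext r; simp [orbDensity]

/-- **Static self-interaction** of the orbital `w` with the kernel `W`: `U[W](w) = re ⟨ρ_w, W ρ_w⟩` (the diagonal
two-body integral `⟨ww|W|ww⟩`; real part taken so that no Hermiticity hypothesis is needed to state it).
[cite: MiyakeAryasetiawan2008, §IV] -/
def selfU (W : Matrix X X ℂ) (w : X → ℂ) : ℝ := (star (orbDensity w) ⬝ᵥ (W *ᵥ orbDensity w)).re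

/-- `U[W](w) = re (ρ_w ⬝ᵥ W ρ_w)` (the density vector is real, so the `star` is immaterial). [folklore] -/
theorem selfU_eq_dotProduct (W : Matrix X X ℂ) (w : X → ℂ) :
    selfU W w = (orbDensity w ⬝ᵥ (W *ᵥ orbDensity w)).re := by
  unfold selfU
  rw [star_orbDensity]

/-- `U[W](w)` as the double sum `re Σ_{r r'} ρ_w(r) W(r,r') ρ_w(r')`. [folklore] -/
theorem selfU_eq_sum (W : Matrix X X ℂ) (w : X → ℂ) :
    selfU W w = (∑ r, ∑ r', orbDensity w r * W r r' * orbDensity w r').re := by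
  rw [selfU_eq_dotProduct]
  congr 1
  simp only [dotProduct, Matrix.mulVec, Finset.mul_sum]
  refine Finset.sum_congr rfl fun r _ => Finset.sum_congr rfl fun r' _ => ?_
  ring

/-- `U[W](w)` is the diagonal two-body integral of lit-1's `WannierGauge.twoBody` for the one-column orbital
matrix: `⟨ww|W|ww⟩`. [cite: MiyakeAryasetiawan2008, §IV] -/
theorem selfU_eq_twoBody (W : Matrix X X ℂ) (w : X → ℂ) :
    selfU W w = (WannierGauge.twoBody (Matrix.of fun r (_ : Unit) => w r) W () () () ()).re := by
  rw [selfU_eq_sum]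
  congr 1
  unfold WannierGauge.twoBody
  refine Finset.sum_congr rfl fun r _ => Finset.sum_congr rfl fun r' _ => ?_
  simp only [Matrix.of_apply, orbDensity_apply]
  ring

variable {n : ℕ}

/-- **Löwner monotonicity of the self-interaction**: `W₁ ≤ W₂` ⇒ `U[W₁](w) ≤ U[W₂](w)` for every orbital.
[cite: VaugierJiangBiermann2012, §IV.A] -/
theorem selfU_mono {W₁ W₂ : Matrix (Fin n) (Fin n) ℂ} (h : W₁ ≤ W₂) (w : Fin n → ℂ) :
    selfU W₁ w ≤ selfU W₂ w :=
  CRPAScreening.quadForm_mono h (orbDensity w)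

/-- **THE ONE-SIDEDNESS OF THE U LEG.** Bare `v > 0`; total polarization `P`; `P₁` the transition pieces inside
the ONE-band target (the antibonding band), `P₃` those inside the THREE-band target; the three-band target
removes more (negative) pieces, `P₃ ≤ P₁`, and the three-band rest is still non-positive, `P − P₃ ≤ 0`. Then for
EVERY orbital `w` — in particular the one-band Wannier orbital — the one-band cRPA self-interaction is at most
the self-interaction with the three-band kernel:
`U[(v⁻¹ − (P − P₁))⁻¹](w) ≤ U[(v⁻¹ − (P − P₃))⁻¹](w)`. [cite: WernerEtAl2015, §III.A];
[cite: VaugierJiangBiermann2012, §IV.A–B] -/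
theorem selfU_oneBand_le_threeBand {v P P₁ P₃ : Matrix (Fin n) (Fin n) ℂ} (hv : v.PosDef)
    (hnest : P₃ ≤ P₁) (hrest : P - P₃ ≤ 0) (w : Fin n → ℂ) :
    selfU (v⁻¹ - (P - P₁))⁻¹ w ≤ selfU (v⁻¹ - (P - P₃))⁻¹ w :=
  selfU_mono (CRPAScreening.targetSpace_monotone hv hnest hrest) w

/-- Any partially screened self-interaction is at most the BARE one: `P_r ≤ 0` ⇒
`U[(v⁻¹ − P_r)⁻¹](w) ≤ U[v](w)`. [cite: VaugierJiangBiermann2012, §IV.A] -/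
theorem selfU_screened_le_bare {v Pr : Matrix (Fin n) (Fin n) ℂ} (hv : v.PosDef) (hPr : Pr ≤ 0)
    (w : Fin n → ℂ) : selfU (v⁻¹ - Pr)⁻¹ w ≤ selfU v w :=
  selfU_mono (CRPAScreening.screened_le_bare hv hPr) w

/-- The FULLY screened self-interaction is at most any partially screened one: `P ≤ P_r ≤ 0` ⇒
`U[(v⁻¹ − P)⁻¹](w) ≤ U[(v⁻¹ − P_r)⁻¹](w)`. [cite: VaugierJiangBiermann2012, §IV.A] -/
theorem selfU_fullyScreened_le_screened {v P Pr : Matrix (Fin n) (Fin n) ℂ} (hv : v.PosDef)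
    (hPPr : P ≤ Pr) (hPr : Pr ≤ 0) (w : Fin n → ℂ) :
    selfU (v⁻¹ - P)⁻¹ w ≤ selfU (v⁻¹ - Pr)⁻¹ w :=
  selfU_mono (CRPAScreening.screened_antitone hv hPPr hPr) w

/-! ## §2 The composite expansion of a one-band orbital in three-band orbitals -/

/-- **Density–density pair integral** of two orbitals (columns `i`, `j` of `A`): `D_{ij}[W] = ρᵢ ⬝ᵥ W ρⱼ`.
[cite: MiyakeAryasetiawan2008, §IV] -/
def densityDensity (A : Matrix X I ℂ) (W : Matrix X X ℂ) (i j : I) : ℂ :=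
  orbDensity (fun x => A x i) ⬝ᵥ (W *ᵥ orbDensity (fun x => A x j))

omit [Fintype I] in
/-- `D_{ij}[W] = ⟨ij|W|ij⟩` (lit-1's `WannierGauge.twoBody A W i j i j`). [cite: SzaboOstlund1996, §3.2.3
Eqs. (3.61)–(3.63)] -/
theorem densityDensity_eq_twoBody (A : Matrix X I ℂ) (W : Matrix X X ℂ) (i j : I) :
    densityDensity A W i j = WannierGauge.twoBody A W i j i j := by
  unfold densityDensity WannierGauge.twoBody
  simp only [dotProduct, Matrix.mulVec, Finset.mul_sum, orbDensity_apply]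
  refine Finset.sum_congr rfl fun r _ => Finset.sum_congr rfl fun r' _ => ?_
  ring

omit [Fintype I] in
/-- The diagonal pair integral is the orbital's self-interaction: `re D_{ii}[W] = U[W](wᵢ)`. [folklore] -/
theorem densityDensity_self_re (A : Matrix X I ℂ) (W : Matrix X X ℂ) (i : I) :
    (densityDensity A W i i).re = selfU W (fun x => A x i) := by
  rw [selfU_eq_dotProduct]; rfl

omit [Fintype X] in
/-- **ZERO DIFFERENTIAL OVERLAP ⇒ the composite density is the weight combination.** If distinct orbitals have
pointwise-disjoint supports (`conj wᵢ(r) · wⱼ(r) = 0` for `i ≠ j` — the density–density reading every cRPA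
table prints), the density of the composite orbital `w = A *ᵥ c` is `ρ_w = Σᵢ |cᵢ|² • ρᵢ`. [folklore] -/
theorem orbDensity_mulVec_of_zdo {A : Matrix X I ℂ} (hA : ∀ r i j, i ≠ j → star (A r i) * A r j = 0)
    (c : I → ℂ) :
    orbDensity (A *ᵥ c) = ∑ i, ((Complex.normSq (c i) : ℝ) : ℂ) • orbDensity (fun x => A x i) := by
  funext r
  rw [Finset.sum_apply, orbDensity_apply]
  simp only [Pi.smul_apply, smul_eq_mul, Matrix.mulVec, dotProduct, star_sum, star_mul, Finset.sum_mul_sum]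
  refine Finset.sum_congr rfl fun i _ => ?_
  rw [Finset.sum_eq_single i]
  · rw [orbDensity_apply, Complex.normSq_eq_conj_mul_self]
    simp only [Complex.star_def]
    ring
  · intro k _ hki
    have h0 : star (A r i) * A r k = 0 := hA r i k (Ne.symm hki)
    calc star (c i) * star (A r i) * (A r k * c k) = star (c i) * c k * (star (A r i) * A r k) := by ring
      _ = 0 := by rw [h0, mul_zero]
  · intro h; exact absurd (Finset.mem_univ i) h

/-- **THE COMPOSITE EXPANSION (`a²`-form with all pair terms).** Under zero differential overlap, the
self-interaction of the composite orbital `w = A *ᵥ c` with ANY kernel `W` is `Σᵢ Σⱼ |cᵢ|²|cⱼ|² · re D_{ij}[W]`.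
[cite: MiyakeAryasetiawan2008, §IV] -/
theorem selfU_mulVec_of_zdo {A : Matrix X I ℂ} (hA : ∀ r i j, i ≠ j → star (A r i) * A r j = 0)
    (W : Matrix X X ℂ) (c : I → ℂ) :
    selfU W (A *ᵥ c) =
      ∑ i, ∑ j, Complex.normSq (c i) * Complex.normSq (c j) * (densityDensity A W i j).re := by
  have key : orbDensity (A *ᵥ c) ⬝ᵥ (W *ᵥ orbDensity (A *ᵥ c)) =
      ∑ i, ∑ j, ((Complex.normSq (c i) : ℝ) : ℂ) * (((Complex.normSq (c j) : ℝ) : ℂ) * densityDensity A W i j) := by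
    rw [orbDensity_mulVec_of_zdo hA, sum_dotProduct]
    refine Finset.sum_congr rfl fun i _ => ?_
    rw [smul_dotProduct, Matrix.mulVec_sum, dotProduct_sum, smul_eq_mul, Finset.mul_sum]
    refine Finset.sum_congr rfl fun j _ => ?_
    rw [Matrix.mulVec_smul, dotProduct_smul, smul_eq_mul]
    rfl
  rw [selfU_eq_dotProduct, key, Complex.re_sum]
  refine Finset.sum_congr rfl fun i _ => ?_
  rw [Complex.re_sum]
  refine Finset.sum_congr rfl fun j _ => ?_
  rw [← mul_assoc, ← Complex.ofReal_mul, Complex.re_ofReal_mul]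

/-! ## §3 Weighted composites: dropping non-negative pair terms lowers them; the `CuO₄` truncation is `bandLevelU` -/

/-- **Weighted composite** of a real pair table `D` with weights `a`: `Σᵢ Σⱼ aᵢ aⱼ D i j` (the `a²`-form of
INFLATION-RULES-3to1-B §B.4 with all pair terms; `aᵢ = |cᵢ|²` the orbital weights). [folklore] -/
def weightedComposite (a : I → ℝ) (D : I → I → ℝ) : ℝ := ∑ i, ∑ j, a i * a j * D i j

/-- Its diagonal part `Σᵢ aᵢ² D i i` (on-site terms only). [folklore] -/
def diagComposite (a : I → ℝ) (D : I → I → ℝ) : ℝ := ∑ i, a i ^ 2 * D i i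

/-- §2 in this vocabulary: under zero differential overlap, `U[W](A *ᵥ c) = weightedComposite (|c ·|²) (re D[W])`.
[folklore] -/
theorem selfU_mulVec_eq_weightedComposite {A : Matrix X I ℂ}
    (hA : ∀ r i j, i ≠ j → star (A r i) * A r j = 0) (W : Matrix X X ℂ) (c : I → ℂ) :
    selfU W (A *ᵥ c) =
      weightedComposite (fun i => Complex.normSq (c i)) (fun i j => (densityDensity A W i j).re) :=
  selfU_mulVec_of_zdo hA W c

/-- **Dropping non-negative off-diagonal pair terms lowers the composite**: non-negative weights and
`0 ≤ D i j` for `i ≠ j` ⇒ `Σᵢ aᵢ² Dᵢᵢ ≤ Σᵢⱼ aᵢaⱼD_{ij}`. [folklore] -/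
theorem diagComposite_le_weightedComposite [DecidableEq I] {a : I → ℝ} {D : I → I → ℝ} (ha : ∀ i, 0 ≤ a i)
    (hD : ∀ i j, i ≠ j → 0 ≤ D i j) : diagComposite a D ≤ weightedComposite a D := by
  unfold diagComposite weightedComposite
  refine Finset.sum_le_sum fun i _ => ?_
  rw [← Finset.add_sum_erase _ _ (Finset.mem_univ i)]
  have hrest : 0 ≤ ∑ j ∈ Finset.univ.erase i, a i * a j * D i j :=
    Finset.sum_nonneg fun j hj => mul_nonneg (mul_nonneg (ha i) (ha j)) (hD i j (Finset.ne_of_mem_erase hj).symm)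
  nlinarith [hrest]

/-- **Weights of the `CuO₄` truncation** of the antibonding orbital: Cu-d weight `w` on the copper (`none`),
`(1 − w)/4` on each of the four surrounding oxygens (`some k`). [folklore] -/
def cuO4Weight (w : ℝ) : Option (Fin 4) → ℝ
  | none => w
  | some _ => (1 - w) / 4

/-- **Pair table of the `CuO₄` truncation**: `U_dd` on Cu, `U_pp` on each O, `U_pd` for every Cu–O pair, and an
inter-oxygen table `V k l` (`k ≠ l`; its diagonal is never read). [folklore] -/
def cuO4Kernel (Udd Upp Upd : ℝ) (V : Fin 4 → Fin 4 → ℝ) : Option (Fin 4) → Option (Fin 4) → ℝ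
  | none, none => Udd
  | none, some _ => Upd
  | some _, none => Upd
  | some k, some l => if k = l then Upp else V k l

/-- The `CuO₄` weights are non-negative for `0 ≤ w ≤ 1`. [folklore] -/
theorem cuO4Weight_nonneg {w : ℝ} (hw0 : 0 ≤ w) (hw1 : w ≤ 1) (i : Option (Fin 4)) : 0 ≤ cuO4Weight w i := by
  cases i with
  | none => simpa [cuO4Weight] using hw0
  | some k => simp only [cuO4Weight]; linarith

/-- The `CuO₄` weights sum to one. [folklore] -/
theorem sum_cuO4Weight (w : ℝ) : ∑ i, cuO4Weight w i = 1 := by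
  rw [Fintype.sum_option]
  simp [cuO4Weight]
  ring

/-- **THE `CuO₄` COMPOSITE IS `bandLevelU` PLUS THE INTER-OXYGEN TERMS**:
`Σᵢⱼ aᵢaⱼD_{ij} = bandLevelU w U_dd U_pp U_pd + ((1 − w)/4)²·Σ_{k ≠ l} V k l` (`w²U_dd` from Cu–Cu,
`4·((1 − w)/4)²U_pp` from the four O diagonals, `2·4·w(1 − w)/4·U_pd` from the eight ordered Cu–O pairs).
[folklore] -/
theorem weightedComposite_cuO4 (w Udd Upp Upd : ℝ) (V : Fin 4 → Fin 4 → ℝ) :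
    weightedComposite (cuO4Weight w) (cuO4Kernel Udd Upp Upd V) =
      bandLevelU w Udd Upp Upd + ((1 - w) / 4) ^ 2 * ∑ k, ∑ l, if k = l then 0 else V k l := by
  unfold weightedComposite bandLevelU
  rw [Fintype.sum_option]
  simp only [Fintype.sum_option, cuO4Weight, cuO4Kernel]
  simp only [Fin.sum_univ_four, Fin.isValue]
  simp
  ring

/-- **`bandLevelU` is BELOW the `CuO₄` composite** whenever the inter-oxygen pair terms are non-negative (any
`w`: the oxygen weight enters squared). [folklore] -/
theorem bandLevelU_le_weightedComposite_cuO4 (w Udd Upp Upd : ℝ) {V : Fin 4 → Fin 4 → ℝ}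
    (hV : ∀ k l, k ≠ l → 0 ≤ V k l) :
    bandLevelU w Udd Upp Upd ≤ weightedComposite (cuO4Weight w) (cuO4Kernel Udd Upp Upd V) := by
  rw [weightedComposite_cuO4]
  have hs : 0 ≤ ∑ k, ∑ l, (if k = l then (0 : ℝ) else V k l) :=
    Finset.sum_nonneg fun k _ => Finset.sum_nonneg fun l _ => by
      split_ifs with h
      · exact le_rfl
      · exact hV k l h
  have := sq_nonneg ((1 - w) / 4)
  nlinarith

/-- The diagonal part of the `CuO₄` composite is the `U_pd := 0`, `V := 0` annex `w²U_dd + (1 − w)²U_pp/4`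
(`U_B|₀` of router §B.24). [folklore] -/
theorem diagComposite_cuO4 (w Udd Upp Upd : ℝ) (V : Fin 4 → Fin 4 → ℝ) :
    diagComposite (cuO4Weight w) (cuO4Kernel Udd Upp Upd V) = bandLevelU w Udd Upp 0 := by
  unfold diagComposite bandLevelU
  rw [Fintype.sum_option]
  simp [cuO4Weight, cuO4Kernel]
  ring

/-! ## §4 The chain in one statement -/

/-- **ONE-BAND `U` ≤ THREE-BAND COMPOSITE.** Common grid `Fin n`; three-band orbitals `A` with ZDO; the
one-band Wannier orbital `A *ᵥ c`; cRPA hypotheses as in `selfU_oneBand_le_threeBand`. Then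
`U_1b = U[(v⁻¹ − (P − P₁))⁻¹](A *ᵥ c) ≤ Σᵢⱼ |cᵢ|²|cⱼ|² re D_{ij}[(v⁻¹ − (P − P₃))⁻¹]` — the one-band cRPA `U` is at
most the `a²`-form composite of the THREE-band cRPA pair table (router: `U_1b ≤ U_B|full` on every (K) parent,
the slack being the p–d screening channel the one-band target integrates out). [cite: WernerEtAl2015, §III.A];
[cite: VaugierJiangBiermann2012, §IV.A–B] -/
theorem selfU_oneBand_le_weightedComposite_of_zdo {A : Matrix (Fin n) I ℂ}
    (hA : ∀ r i j, i ≠ j → star (A r i) * A r j = 0) (c : I → ℂ)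
    {v P P₁ P₃ : Matrix (Fin n) (Fin n) ℂ} (hv : v.PosDef) (hnest : P₃ ≤ P₁) (hrest : P - P₃ ≤ 0) :
    selfU (v⁻¹ - (P - P₁))⁻¹ (A *ᵥ c) ≤
      weightedComposite (fun i => Complex.normSq (c i))
        (fun i j => (densityDensity A (v⁻¹ - (P - P₃))⁻¹ i j).re) := by
  rw [← selfU_mulVec_eq_weightedComposite hA]
  exact selfU_oneBand_le_threeBand hv hnest hrest _

/-- With ONE kernel on both sides the composite expansion is an identity (the bare-level calibration test of
router §B.28: `V_1b = Σᵢⱼ aᵢaⱼ V_{ij}` exactly under ZDO and a common basis; the located residual of the `CuO₄`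
truncation is the size of the omitted pair terms and tails). [folklore] -/
theorem selfU_bare_eq_weightedComposite_of_zdo {A : Matrix X I ℂ}
    (hA : ∀ r i j, i ≠ j → star (A r i) * A r j = 0) (v : Matrix X X ℂ) (c : I → ℂ) :
    selfU v (A *ᵥ c) =
      weightedComposite (fun i => Complex.normSq (c i)) (fun i j => (densityDensity A v i j).re) :=
  selfU_mulVec_eq_weightedComposite hA v c

/-! ## §5 The exact four-index expansion and the one-sidedness WITHOUT any overlap hypothesis
(appended 2026-08-27: `U[W](A *ᵥ c) = re Σ_{ijkl} conj cᵢ conj cⱼ c_k c_l ⟨ij|W|kl⟩`; the §2 `a²`-form is its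
`i = k, j = l` part, the remainder — exchange / overlap-density integrals — is what router §B.28 bounds in aggregate) -/

/-- **Pair density** of two orbitals weighted by the composite's coefficients:
`M_{ik}(r) = conj cᵢ · c_k · conj wᵢ(r) · w_k(r)` (so that `ρ_{A c} = Σ_{ik} M_{ik}`). [folklore] -/
def pairDensity (A : Matrix X I ℂ) (c : I → ℂ) (i k : I) : X → ℂ :=
  fun r => star (c i) * c k * (star (A r i) * A r k)

omit [Fintype X] in
/-- The composite density is the double sum of pair densities, `ρ_{A c} = Σᵢ Σ_k M_{ik}`. [folklore] -/
theorem orbDensity_mulVec_eq_sum_pairDensity (A : Matrix X I ℂ) (c : I → ℂ) :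
    orbDensity (A *ᵥ c) = ∑ i, ∑ k, pairDensity A c i k := by
  funext r
  rw [Finset.sum_apply, orbDensity_apply]
  simp only [Finset.sum_apply, pairDensity, Matrix.mulVec, dotProduct, star_sum, star_mul,
    Finset.sum_mul_sum]
  refine Finset.sum_congr rfl fun i _ => Finset.sum_congr rfl fun k _ => ?_
  ring

omit [Fintype I] in
/-- One pair density against another through the kernel is a two-body integral:
`M_{ik} ⬝ᵥ W M_{jl} = conj cᵢ conj cⱼ c_k c_l · ⟨ij|W|kl⟩`. [cite: MiyakeAryasetiawan2008, §IV] -/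
theorem pairDensity_dotProduct_mulVec (A : Matrix X I ℂ) (W : Matrix X X ℂ) (c : I → ℂ) (i j k l : I) :
    pairDensity A c i k ⬝ᵥ (W *ᵥ pairDensity A c j l) =
      star (c i) * star (c j) * c k * c l * WannierGauge.twoBody A W i j k l := by
  unfold WannierGauge.twoBody
  simp only [dotProduct, Matrix.mulVec, pairDensity, Finset.mul_sum]
  refine Finset.sum_congr rfl fun r _ => Finset.sum_congr rfl fun r' _ => ?_
  ring

/-- **THE EXACT FOUR-INDEX EXPANSION.** For any orbital set `A`, coefficients `c` and kernel `W`: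
`U[W](A *ᵥ c) = re Σᵢ Σⱼ Σ_k Σ_l conj cᵢ conj cⱼ c_k c_l ⟨ij|W|kl⟩` (lit-1's `WannierGauge.twoBody`). The §2 `a²`-form is
the `i = k, j = l` part. [cite: MiyakeAryasetiawan2008, §IV]; [cite: SzaboOstlund1996, §3.2.3] -/
theorem selfU_mulVec_eq_sum_twoBody (A : Matrix X I ℂ) (W : Matrix X X ℂ) (c : I → ℂ) :
    selfU W (A *ᵥ c) =
      (∑ i, ∑ j, ∑ k, ∑ l, star (c i) * star (c j) * c k * c l * WannierGauge.twoBody A W i j k l).re := by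
  rw [selfU_eq_dotProduct, orbDensity_mulVec_eq_sum_pairDensity]
  congr 1
  rw [sum_dotProduct]
  refine Finset.sum_congr rfl fun i _ => ?_
  rw [sum_dotProduct]
  simp only [Matrix.mulVec_sum, dotProduct_sum, pairDensity_dotProduct_mulVec]
  rw [Finset.sum_comm]

/-- **ONE-SIDEDNESS WITHOUT ANY OVERLAP HYPOTHESIS.** Common grid `Fin n`; three-band orbitals `A`, one-band
orbital `A *ᵥ c`; cRPA hypotheses as in `selfU_oneBand_le_threeBand`. Then the one-band cRPA `U` is at most the
FULL four-index composite of the THREE-band two-body integrals: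
`U_1b ≤ re Σ_{ijkl} conj cᵢ conj cⱼ c_k c_l ⟨ij|U^{3b}|kl⟩`. [cite: WernerEtAl2015, §III.A];
[cite: VaugierJiangBiermann2012, §IV.A–B] -/
theorem selfU_oneBand_le_sum_twoBody (A : Matrix (Fin n) I ℂ) (c : I → ℂ)
    {v P P₁ P₃ : Matrix (Fin n) (Fin n) ℂ} (hv : v.PosDef) (hnest : P₃ ≤ P₁) (hrest : P - P₃ ≤ 0) :
    selfU (v⁻¹ - (P - P₁))⁻¹ (A *ᵥ c) ≤
      (∑ i, ∑ j, ∑ k, ∑ l, star (c i) * star (c j) * c k * c l *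
        WannierGauge.twoBody A (v⁻¹ - (P - P₃))⁻¹ i j k l).re := by
  rw [← selfU_mulVec_eq_sum_twoBody]
  exact selfU_oneBand_le_threeBand hv hnest hrest _

end Summit.Ventures.CertifiedManyBodySolver.Downfold.Emery

end
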